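import Summits.QuantumFields.YangMills.Theorems.BalabanUVNodesPortS1G3CLocOps
import Summits.QuantumFields.YangMills.Theorems.BalabanUVNodesPortS1G3CInvariance

/-!
# NODE O port PT-A — `stub_G3C` (repaired edition `G3CAtRecordL`), layer (D1c): COVARIANCE of the X-localized operators and of the local inverses under the (1.10) action — from (P3) of the
# P0-ℂ body: `T^{(Z)}(u·φ) = A·T^{(Z)}(φ)·A⁻¹` and `G_Z(x, u·φ) = A·G_Z(x, φ)·A⁻¹` on the non-`b₀` index, `A = AdM(u)|_{NonB0}` a unit, for EVERY pair `φ` (junk included) — the (g6) tool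

Cell `ym-nodeO-ideate`, porter hand `hand-27930-G3C` (g0); proof kind, `--supports stmt-QuantumFields-27930 --as helper`; count-neutral.  [I] = [Balaban1987RG1], [B9] = [Balaban1985BackgroundPropagators].

WHY.  Row (g6) of `G3CPiecesAt` (invariance of the resolvent pieces under `Sect2.cAct u`) is proved TERMWISE on the walk terms of the repaired road (memo §5b), whose factors are the
X-localized operators `T^{(Z)}` and local inverses `G_Z` of ✓`…PortS1G3CLocOps`, the sticking-out parts `E_□` and the cube indicators.  (P3) gives piecewise covariance with a bond-block-diagonal unit
`AdM n u`; since `g3cInDom Z i` depends on the bond of `i` only, `AdM` has vanishing off-blocks for the domain predicate too, so conjugation passes to `T^{(Z)}`, to the restricted resolvent block,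
through `Matrix.inv` (✓`G3CInv.*`) and back through the extension by zero.

WHAT THIS FILE PROVES (sorry-free): `g3cLocOp_cAct` (`T^{(Z)}` conjugates), `adM_offblock_inDom` (the non-`b₀` block of `AdM` has vanishing off-blocks for `g3cInDom Z`),
`g3cLocBlock_cAct` (the restricted resolvent block conjugates by `A|_Z`), generic `G3CInv.inv_offblock` ∕ `G3CInv.conj_extend_eq` (inverse and extension-by-zero of block-diagonal units),
`g3cLocInv_eq_extend`, ★ `g3cLocInv_cAct` (`G_Z(x, u·φ) = A·G_Z(x, φ)·A⁻¹`).

HONEST FRAMING.  Algebra under the HYPOTHESIS `P0CarrierClauses …` (inhabited nowhere); nothing of Bałaban's estimates asserted, ported or discharged; `stub_G3C` NOT closed; 27930 OPEN; NODE O 0∕1;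
COUNT 8∕28 · K 1∕4 UNMOVED; finite `𝕋⁴_{L^K}` at fixed ε — NOT continuum ∕ OS ∕ Clay; **the Yang–Mills mass gap is NOT proved by any of this.**  No `sorry`, no `instance`, no `notation`, no `def`;
standard axioms.
-/

noncomputable section

open scoped BigOperators Matrix.Norms.L2Operator Topology Matrix Classical
open Filter Finset

namespace Summit.QuantumFields.YangMills.Theorems.BalabanUVNodesPortS1

open Summit.QuantumFields.YangMills.Theorems.K0RecordFormatNames
open Literature.MathematicalPhysics.QuantumFieldTheory.Balaban1983to89
open Literature.MathematicalPhysics.QuantumFieldTheory.Balaban1983to89.Node00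
open Literature.MathematicalPhysics.QuantumFieldTheory.Balaban1983to89.T4Continuum (T4Family)

section Gauge

variable {F : T4Family}
variable {a₀ δ₀ c₀ γ₀ γ₁ : ℝ} {Mc : ℕ} {α₀ α₁ ε₂₉ : ℝ} {k : ℕ}
variable {TC : (n : ℕ) → Sect2.CPair (F.P (recordK₀ F Mc k + n)) (MatA 2) → FluctIdx F k (recordK₀ F Mc k + n) → FluctIdx F k (recordK₀ F Mc k + n) → ℂ}
variable {TY : (n : ℕ) → (recordDomSys F Mc k (recordK₀ F Mc k + n)).Dom → Sect2.CPair (F.P (recordK₀ F Mc k + n)) (MatA 2) →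
  FluctIdx F k (recordK₀ F Mc k + n) → FluctIdx F k (recordK₀ F Mc k + n) → ℂ}
variable {TZY : Finset (Fin 4 → ℤ) → IntBondCfg → ((Fin 4 → ℤ) × Fin 4) × Fin 3 → ((Fin 4 → ℤ) × Fin 4) × Fin 3 → ℂ}
variable {AdM : (n : ℕ) → (Site (F.P (recordK₀ F Mc k + n)) 0 → (MatA 2)ˣ) →
  Matrix (FluctIdx F k (recordK₀ F Mc k + n)) (FluctIdx F k (recordK₀ F Mc k + n)) ℂ}
variable {AdZ : ((Fin 4 → ℤ) → (MatA 2)ˣ) → (Fin 4 → ℤ) × Fin 4 → Matrix (Fin 3) (Fin 3) ℂ}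

/-- ★ **`T^{(Z)}` CONJUGATES**: `T^{(Z)}(u·φ) = A·T^{(Z)}(φ)·A⁻¹` with `A = AdM(u)|_{NonB0}` a unit — for EVERY pair `φ`. [cite: Balaban1987RG1, (1.10) p.262, (1.19) p.263] -/
theorem g3cLocOp_cAct (hP : P0CarrierClauses F a₀ δ₀ c₀ γ₀ γ₁ Mc α₀ α₁ ε₂₉ k TC TY TZY AdM AdZ) (n : ℕ)
    (Z : (recordDomSys F Mc k (recordK₀ F Mc k + n)).Dom) (u : Site (F.P (recordK₀ F Mc k + n)) 0 → (MatA 2)ˣ)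
    (φ : Sect2.CPair (F.P (recordK₀ F Mc k + n)) (MatA 2)) :
    IsUnit ((AdM n u).submatrix (Subtype.val : NonB0Idx F k (recordK₀ F Mc k + n) → FluctIdx F k (recordK₀ F Mc k + n)) Subtype.val).det ∧
    g3cLocOp F Mc k (recordK₀ F Mc k + n) (TY n) Z (Sect2.cAct u φ) =
      (AdM n u).submatrix (Subtype.val : NonB0Idx F k (recordK₀ F Mc k + n) → _) Subtype.val *
        g3cLocOp F Mc k (recordK₀ F Mc k + n) (TY n) Z φ *
        ((AdM n u).submatrix (Subtype.val : NonB0Idx F k (recordK₀ F Mc k + n) → _) Subtype.val)⁻¹ := by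
  obtain ⟨-, -, -, -, -, -, hP3, -⟩ := hP
  obtain ⟨hU, hBlk, hCov⟩ := hP3 n u
  have hdet : IsUnit (AdM n u).det := (Matrix.isUnit_iff_isUnit_det _).1 hU
  have hoff : ∀ i j : FluctIdx F k (recordK₀ F Mc k + n),
      ¬ ((i.1 ∉ Set.range (recordB0 F k (recordK₀ F Mc k + n))) ↔ (j.1 ∉ Set.range (recordB0 F k (recordK₀ F Mc k + n)))) → AdM n u i j = 0 := by
    intro i j hij; apply hBlk i j; intro hb; apply hij; rw [hb]
  refine ⟨G3CInv.isUnit_det_submatrix_of_offblock (fun i j hi hj => hoff i j (by tauto)) hdet, ?_⟩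
  -- the filtered sum of pieces as a FluctIdx-matrix conjugates, then restrict to the non-b₀ block
  have hsum : ∀ ψ : Sect2.CPair (F.P (recordK₀ F Mc k + n)) (MatA 2),
      g3cLocOp F Mc k (recordK₀ F Mc k + n) (TY n) Z ψ =
        (∑ Y ∈ (Finset.univ : Finset (recordDomSys F Mc k (recordK₀ F Mc k + n)).Dom).filter (fun Y => Y.1 ⊆ Z.1), Matrix.of (TY n Y ψ)).submatrix
          (Subtype.val : NonB0Idx F k (recordK₀ F Mc k + n) → _) Subtype.val := by
    intro ψ; ext i j
    rw [g3cLocOp, Matrix.of_apply, Matrix.submatrix_apply, Matrix.sum_apply]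
    rfl
  have hconj : (∑ Y ∈ (Finset.univ : Finset (recordDomSys F Mc k (recordK₀ F Mc k + n)).Dom).filter (fun Y => Y.1 ⊆ Z.1), Matrix.of (TY n Y (Sect2.cAct u φ))) =
      AdM n u * (∑ Y ∈ (Finset.univ : Finset (recordDomSys F Mc k (recordK₀ F Mc k + n)).Dom).filter (fun Y => Y.1 ⊆ Z.1), Matrix.of (TY n Y φ)) * (AdM n u)⁻¹ := by
    rw [Finset.mul_sum, Finset.sum_mul]
    exact Finset.sum_congr rfl fun Y _ => hCov Y φ
  rw [hsum, hsum, hconj, G3CInv.submatrix_conj_of_offblock hoff hdet]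

/-- **The non-`b₀` block of `AdM(u)` has vanishing off-blocks for the domain predicate** (`g3cInDom Z i` reads the bond of `i` only). [cite: Balaban1987RG1, (1.10) p.262 (bookkeeping)] -/
theorem adM_offblock_inDom (hP : P0CarrierClauses F a₀ δ₀ c₀ γ₀ γ₁ Mc α₀ α₁ ε₂₉ k TC TY TZY AdM AdZ) (n : ℕ)
    (Z : (recordDomSys F Mc k (recordK₀ F Mc k + n)).Dom) (u : Site (F.P (recordK₀ F Mc k + n)) 0 → (MatA 2)ˣ)
    (i j : NonB0Idx F k (recordK₀ F Mc k + n))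
    (hij : ¬ (g3cInDom F Mc k (recordK₀ F Mc k + n) Z i ↔ g3cInDom F Mc k (recordK₀ F Mc k + n) Z j)) :
    (AdM n u).submatrix (Subtype.val : NonB0Idx F k (recordK₀ F Mc k + n) → _) Subtype.val i j = 0 := by
  obtain ⟨-, -, -, -, -, -, hP3, -⟩ := hP
  obtain ⟨-, hBlk, -⟩ := hP3 n u
  rw [Matrix.submatrix_apply]
  apply hBlk
  intro hb
  apply hij
  unfold g3cInDom
  rw [hb]

/-- **The restricted resolvent block conjugates**: `x·1 + T^{(Z)}(u·φ)|_Z = A|_Z·(x·1 + T^{(Z)}(φ)|_Z)·(A|_Z)⁻¹`. [cite: Balaban1987RG1, (1.10) p.262, (1.19) p.263] -/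
theorem g3cLocBlock_cAct (hP : P0CarrierClauses F a₀ δ₀ c₀ γ₀ γ₁ Mc α₀ α₁ ε₂₉ k TC TY TZY AdM AdZ) (n : ℕ)
    (Z : (recordDomSys F Mc k (recordK₀ F Mc k + n)).Dom) (u : Site (F.P (recordK₀ F Mc k + n)) 0 → (MatA 2)ˣ) (x : ℝ)
    (φ : Sect2.CPair (F.P (recordK₀ F Mc k + n)) (MatA 2)) :
    let A := (AdM n u).submatrix (Subtype.val : NonB0Idx F k (recordK₀ F Mc k + n) → _) Subtype.val
    let AZ := A.submatrix (Subtype.val : {i : NonB0Idx F k (recordK₀ F Mc k + n) // g3cInDom F Mc k (recordK₀ F Mc k + n) Z i} → _) Subtype.val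
    IsUnit AZ.det ∧
    g3cLocBlock F Mc k (recordK₀ F Mc k + n) (TY n) Z x (Sect2.cAct u φ) = AZ * g3cLocBlock F Mc k (recordK₀ F Mc k + n) (TY n) Z x φ * AZ⁻¹ := by
  intro A AZ
  obtain ⟨hA, hT⟩ := g3cLocOp_cAct hP n Z u φ
  have hoff : ∀ i j : NonB0Idx F k (recordK₀ F Mc k + n),
      ¬ (g3cInDom F Mc k (recordK₀ F Mc k + n) Z i ↔ g3cInDom F Mc k (recordK₀ F Mc k + n) Z j) → A i j = 0 :=
    fun i j hij => adM_offblock_inDom hP n Z u i j hij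
  have hAZ : IsUnit AZ.det := G3CInv.isUnit_det_submatrix_of_offblock (fun i j hi hj => hoff i j (by tauto)) hA
  refine ⟨hAZ, ?_⟩
  have hAZinv : AZ * AZ⁻¹ = 1 := Matrix.mul_nonsing_inv _ hAZ
  rw [g3cLocBlock, g3cLocBlock, hT, G3CInv.submatrix_conj_of_offblock hoff hA]
  rw [Matrix.mul_add, Matrix.add_mul, Matrix.mul_smul, Matrix.mul_one, Matrix.smul_mul, hAZinv]

end Gauge

/-! ## Generic: inverses and extensions by zero of block-diagonal units -/

namespace G3CInv

variable {ι : Type*} [Fintype ι] [DecidableEq ι] {R : Type*} [CommRing R]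

/-- **The inverse of a block-diagonal unit is block-diagonal**: if both off-blocks of `A` vanish for the predicate `p` and `IsUnit A.det`, both off-blocks of `A⁻¹` vanish. [folklore] -/
theorem inv_offblock {p : ι → Prop} [DecidablePred p] {A : Matrix ι ι R} (hA : ∀ i j, ¬ (p i ↔ p j) → A i j = 0) (hU : IsUnit A.det)
    (i j : ι) (hij : ¬ (p i ↔ p j)) : A⁻¹ i j = 0 := by
  set P : Matrix ι ι R := Matrix.diagonal fun i => if p i then (1 : R) else 0 with hP
  have hcomm : P * A = A * P := by
    ext a b
    rw [hP, Matrix.diagonal_mul, Matrix.mul_diagonal]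
    by_cases ha : p a
    · by_cases hb : p b
      · simp [ha, hb]
      · simp [ha, hb, hA a b (by tauto)]
    · by_cases hb : p b
      · simp [ha, hb, hA a b (by tauto)]
      · simp [ha, hb]
  have hinv : P * A⁻¹ = A⁻¹ * P := by
    calc P * A⁻¹ = A⁻¹ * A * P * A⁻¹ := by rw [Matrix.nonsing_inv_mul _ hU, Matrix.one_mul]
      _ = A⁻¹ * (A * P) * A⁻¹ := by simp only [Matrix.mul_assoc]
      _ = A⁻¹ * (P * A) * A⁻¹ := by rw [hcomm]
      _ = A⁻¹ * P * (A * A⁻¹) := by simp only [Matrix.mul_assoc]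
      _ = A⁻¹ * P := by rw [Matrix.mul_nonsing_inv _ hU, Matrix.mul_one]
  have h := congr_fun (congr_fun hinv i) j
  rw [hP, Matrix.diagonal_mul, Matrix.mul_diagonal] at h
  by_cases hi : p i
  · by_cases hj : p j
    · exact absurd (iff_of_true hi hj) hij
    · simpa [hi, hj] using h
  · by_cases hj : p j
    · simpa [hi, hj] using h.symm
    · exact absurd (iff_of_false hi hj) hij

/-- **Conjugating an extension by zero**: for a block-diagonal unit `A`, `A · ext(M) · A⁻¹ = ext(A|_p · M · (A|_p)⁻¹)`. [folklore] -/
theorem conj_extend_eq {p : ι → Prop} [DecidablePred p] {A : Matrix ι ι R} (hA : ∀ i j, ¬ (p i ↔ p j) → A i j = 0) (hU : IsUnit A.det)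
    (M : Matrix {i // p i} {i // p i} R) :
    A * (Matrix.of fun i j : ι => if hi : p i then (if hj : p j then M ⟨i, hi⟩ ⟨j, hj⟩ else 0) else 0) * A⁻¹ =
      Matrix.of fun i j : ι => if hi : p i then (if hj : p j then
        (A.submatrix (Subtype.val : {i // p i} → ι) (Subtype.val : {i // p i} → ι) * M *
          (A.submatrix (Subtype.val : {i // p i} → ι) (Subtype.val : {i // p i} → ι))⁻¹) ⟨i, hi⟩ ⟨j, hj⟩ else 0) else 0 := by
  have hAL : ∀ i l, p i → ¬ p l → A i l = 0 := fun i l hi hl => hA i l (by tauto)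
  have hAR : ∀ l j, ¬ p l → p j → A l j = 0 := fun l j hl hj => hA l j (by tauto)
  have hIL : ∀ m j, p m → ¬ p j → A⁻¹ m j = 0 := fun m j hm hj => inv_offblock hA hU m j (by tauto)
  set E : Matrix ι ι R := Matrix.of fun i j : ι => if hi : p i then (if hj : p j then M ⟨i, hi⟩ ⟨j, hj⟩ else 0) else 0 with hE
  have hE0l : ∀ l m, ¬ p l → E l m = 0 := fun l m hl => by rw [hE, Matrix.of_apply, dif_neg hl]
  have hE0r : ∀ l m, ¬ p m → E l m = 0 := fun l m hm => by
    rw [hE, Matrix.of_apply]; by_cases hl : p l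
    · rw [dif_pos hl, dif_neg hm]
    · rw [dif_neg hl]
  have hE1 : ∀ (l m : {i // p i}), E l.1 m.1 = M l m := fun l m => by rw [hE, Matrix.of_apply, dif_pos l.2, dif_pos m.2]
  ext i j
  rw [Matrix.of_apply]
  by_cases hi : p i
  · by_cases hj : p j
    · rw [dif_pos hi, dif_pos hj, ← submatrix_inv_of_offblock hAL hU]
      simp only [Matrix.mul_apply, Matrix.submatrix_apply]
      rw [← Fintype.sum_subtype_add_sum_subtype p (fun m => (∑ l, A i l * E l m) * A⁻¹ m j)]
      rw [Finset.sum_eq_zero (s := (Finset.univ : Finset {m // ¬ p m}))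
        (fun m _ => by rw [Finset.sum_eq_zero (fun l _ => by rw [hE0r l m.1 m.2, mul_zero]), zero_mul]), add_zero]
      refine Finset.sum_congr rfl fun m _ => ?_
      congr 1
      rw [← Fintype.sum_subtype_add_sum_subtype p (fun l => A i l * E l m.1)]
      rw [Finset.sum_eq_zero (s := (Finset.univ : Finset {l // ¬ p l})) (fun l _ => by rw [hE0l l.1 m.1 l.2, mul_zero]), add_zero]
      exact Finset.sum_congr rfl fun l _ => by rw [hE1]
    · rw [dif_pos hi, dif_neg hj, Matrix.mul_apply]
      refine Finset.sum_eq_zero fun m _ => ?_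
      by_cases hm : p m
      · rw [hIL m j hm hj, mul_zero]
      · rw [Matrix.mul_apply, Finset.sum_eq_zero (fun l _ => by rw [hE0r l m hm, mul_zero]), zero_mul]
  · rw [dif_neg hi, Matrix.mul_apply]
    refine Finset.sum_eq_zero fun m _ => ?_
    rw [Matrix.mul_apply, Finset.sum_eq_zero (fun l _ => ?_), zero_mul]
    by_cases hl : p l
    · rw [hAR i l hi hl, zero_mul]
    · rw [hE0l l m hl, mul_zero]

end G3CInv

section Gauge2

variable {F : T4Family}
variable {a₀ δ₀ c₀ γ₀ γ₁ : ℝ} {Mc : ℕ} {α₀ α₁ ε₂₉ : ℝ} {k : ℕ}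
variable {TC : (n : ℕ) → Sect2.CPair (F.P (recordK₀ F Mc k + n)) (MatA 2) → FluctIdx F k (recordK₀ F Mc k + n) → FluctIdx F k (recordK₀ F Mc k + n) → ℂ}
variable {TY : (n : ℕ) → (recordDomSys F Mc k (recordK₀ F Mc k + n)).Dom → Sect2.CPair (F.P (recordK₀ F Mc k + n)) (MatA 2) →
  FluctIdx F k (recordK₀ F Mc k + n) → FluctIdx F k (recordK₀ F Mc k + n) → ℂ}
variable {TZY : Finset (Fin 4 → ℤ) → IntBondCfg → ((Fin 4 → ℤ) × Fin 4) × Fin 3 → ((Fin 4 → ℤ) × Fin 4) × Fin 3 → ℂ}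
variable {AdM : (n : ℕ) → (Site (F.P (recordK₀ F Mc k + n)) 0 → (MatA 2)ˣ) →
  Matrix (FluctIdx F k (recordK₀ F Mc k + n)) (FluctIdx F k (recordK₀ F Mc k + n)) ℂ}
variable {AdZ : ((Fin 4 → ℤ) → (MatA 2)ˣ) → (Fin 4 → ℤ) × Fin 4 → Matrix (Fin 3) (Fin 3) ℂ}

/-- The local inverse IS the extension by zero of the inverse of the restricted block. [cite: Balaban1985BackgroundPropagators, (3.87) p.409 (bookkeeping)] -/
theorem g3cLocInv_eq_extend (Mc k K : ℕ) (TYK : (recordDomSys F Mc k K).Dom → Sect2.CPair (F.P K) (MatA 2) → FluctIdx F k K → FluctIdx F k K → ℂ)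
    (Z : (recordDomSys F Mc k K).Dom) (x : ℝ) (φ : Sect2.CPair (F.P K) (MatA 2)) :
    g3cLocInv F Mc k K TYK Z x φ = Matrix.of fun i j : NonB0Idx F k K =>
      if hi : g3cInDom F Mc k K Z i then (if hj : g3cInDom F Mc k K Z j then (g3cLocBlock F Mc k K TYK Z x φ)⁻¹ ⟨i, hi⟩ ⟨j, hj⟩ else 0) else 0 := by
  ext i j; rfl

/-- ★ **THE LOCAL INVERSE CONJUGATES**: `G_Z(x, u·φ) = A·G_Z(x, φ)·A⁻¹` on the non-`b₀` index, for EVERY pair `φ` and every `x` — the (g6) tool for the walk terms.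
[cite: Balaban1987RG1, (1.19) p.263, (1.10) p.262; Balaban1985BackgroundPropagators, (3.87) p.409] -/
theorem g3cLocInv_cAct (hP : P0CarrierClauses F a₀ δ₀ c₀ γ₀ γ₁ Mc α₀ α₁ ε₂₉ k TC TY TZY AdM AdZ) (n : ℕ)
    (Z : (recordDomSys F Mc k (recordK₀ F Mc k + n)).Dom) (u : Site (F.P (recordK₀ F Mc k + n)) 0 → (MatA 2)ˣ) (x : ℝ)
    (φ : Sect2.CPair (F.P (recordK₀ F Mc k + n)) (MatA 2)) :
    g3cLocInv F Mc k (recordK₀ F Mc k + n) (TY n) Z x (Sect2.cAct u φ) =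
      (AdM n u).submatrix (Subtype.val : NonB0Idx F k (recordK₀ F Mc k + n) → _) Subtype.val *
        g3cLocInv F Mc k (recordK₀ F Mc k + n) (TY n) Z x φ *
        ((AdM n u).submatrix (Subtype.val : NonB0Idx F k (recordK₀ F Mc k + n) → _) Subtype.val)⁻¹ := by
  obtain ⟨hA, -⟩ := g3cLocOp_cAct hP n Z u φ
  obtain ⟨hAZ, hblock⟩ := g3cLocBlock_cAct hP n Z u x φ
  have hoff : ∀ i j : NonB0Idx F k (recordK₀ F Mc k + n),
      ¬ (g3cInDom F Mc k (recordK₀ F Mc k + n) Z i ↔ g3cInDom F Mc k (recordK₀ F Mc k + n) Z j) →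
        (AdM n u).submatrix (Subtype.val : NonB0Idx F k (recordK₀ F Mc k + n) → _) Subtype.val i j = 0 :=
    fun i j hij => adM_offblock_inDom hP n Z u i j hij
  rw [g3cLocInv_eq_extend, g3cLocInv_eq_extend, G3CInv.conj_extend_eq hoff hA, hblock, G3CInv.inv_conj hAZ]

end Gauge2


end Summit.QuantumFields.YangMills.Theorems.BalabanUVNodesPortS1

end
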